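import Mathlib.Analysis.SpecialFunctions.Pow.Deriv
import Mathlib.Analysis.SpecialFunctions.Pow.Asymptotics
import HarnessLib

/-!
# Barkley 2020: the velocity-gradient laws on the critical ring of the Luo–Hou ("teacup") flow —
# the printed algebra and its explicit `γ`-law, PROVED (kernel bookkeeping; no named fact)

D. Barkley, *A fluid mechanic's analysis of the teacup singularity*, Proc. R. Soc. A **476**
(2020) 20200348 = arXiv:1902.05993 [Barkley2020Teacup] (held text `paper:arxiv-1902.05993`,
chunks p0006–p0007 (§3), p0011–p0012 (§6), p0014 (§7) opened).

HONEST FRAMING (cell ns-blowup, D-0081 §A1 zone Z8 «Hou–Luo corner analogue WITHOUT boundary»;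
sheet `profile/lit2/ZONE-LIT-Z8.md` §2). Barkley's paper is a MECHANICS analysis of the Luo–Hou
axisymmetric Euler computation (3-D Euler WITH a wall; numerics) — it proves no theorem about
Euler. What it PRINTS as exact algebra is the velocity-gradient dynamics on the CRITICAL RING
(wall `r = 1` ∩ symmetry plane `z = 0`), §3 (chunk p0006): "Symmetries dictate that on the
critical ring the only non-zero derivatives … are `W ≡ ∂_z u_z`, `Ω ≡ ∂_z u_θ`, `V ≡ ∂_r u_r`,
`P ≡ ∂_zz p`, `Q ≡ ∂_rr p` … Straightforward differentiation … gives `Ẇ + W² = −P`,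
`Ω̇ + WΩ = 0`, `V̇ + V² = −Q`. By incompressibility on the critical ring: `V + W = 0` … giving
`Ẇ + W² = −P`, `Ω̇ + WΩ = 0`, `P + Q = −2W²` … The equations are exact, and while they are not
closed … they are extremely useful"; the ratio `a² ≡ Q/P` (eq:a2) turns them into
"`Ẇ = −W²/γ`, `Ω̇ = −WΩ` where `γ ≡ (a²+1)/(a²−1) = (Q+P)/(Q−P)`" (eq:main2, eq:gamma; "The case of
interest `∞ > a > 1` corresponds to `1 < γ < ∞`"), and §3 (chunk p0007): "The solution to
eq:main2 with `γ` constant is … `W(t) = −γ/(T−t) ∼ (T−t)⁻¹`, `Ω(t) = Ω₀T^γ/(T−t)^γ ∼ (T−t)^{−γ}`,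
where `T = −γ/W₀ > 0` is the singularity time … We know from LH that the vorticity diverges with
exponent `γ ≃ 2.46`, corresponding to `a ≃ 1.54`."

This file PROVES that printed algebra as real-variable identities (the "equations are exact" part
is about Euler and is NOT asserted here — it would be a theorem about `IsClassicalEulerOnDomain`
solutions in the Luo–Hou symmetry class, not attempted): the elimination `(Ẇ + W² = −P,
P + Q = −2W², Q = a²P) ⇒ Ẇ = −W²/γ(a)`, `γ(a) = (Q+P)/(Q−P)`, `a² = (γ+1)/(γ−1)`, the explicit
`γ`-constant solution (derivatives by Mathlib's `HasDerivAt.inv` / `HasDerivAt.rpow_const`), its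
blow-up time `T = −γ/W₀`, the divergences `W → −∞`, `Ω → +∞` as `t ↑ T`, and the arithmetic of the
printed pair `(γ, a) ≃ (2.46, 1.54)`. It is the by-name bookkeeping the Z8 sheet uses when it
compares a mirror-plane stagnation ring (no wall) with Barkley's wall ring; Barkley's own open
question (§7, p0014: "whether an Euler solution can exhibit blowup in a configuration without a
pressure field originating from flow confinement") is quoted in the sheet, not formalised.

## Contents (namespace `Literature.Analysis.FluidPDE.Barkley2020`; all PROVED, 0 facts)

* `gammaOfRatio a = (a²+1)/(a²−1)`; `gammaOfRatio_eq_curvatures` (`= (Q+P)/(Q−P)` when `a² = Q/P`);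
  `sq_ratio_eq_of_gamma` (`a² = (γ+1)/(γ−1)`); `one_lt_gammaOfRatio` (`a > 1 ⇒ γ > 1`).
* `pressureCurvature_eq` (`P = −2W²/(a²+1)`), `gradient_law` (`Ẇ = −W²/γ(a)`).
* `ringW γ T t = −γ/(T−t)`, `ringOmega Ω₀ γ T t = Ω₀ T^γ (T−t)^{−γ}` with `ringOmega_eq_div`;
  `hasDerivAt_ringW` (`Ẇ = −W²/γ`), `hasDerivAt_ringOmega` (`Ω̇ = −WΩ`), `ringW_zero` /
  `blowupTime_eq` (`T = −γ/W₀`), `tendsto_ringW_atBot`, `tendsto_ringOmega_atTop`.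
* data `gammaLH = 2.46`, `aLH = 1.54`, `gammaModelFit = 2.31`, `modelBlowupTime = 2.250` (§3, §6.2
  printed numbers) with `abs_aLH_sq_sub_lt` (consistency of the printed pair to `2·10⁻³`) and
  `gammaModelFit_lt_gammaLH`.

WHAT THIS IS NOT: not Navier–Stokes, not a statement about Euler solutions — real-variable
algebra/ODE facts printed in a mechanics paper about a 3-D Euler computation WITH a wall (MODEL /
numerics context; «not NS»).

## References

* D. Barkley, Proc. R. Soc. A 476 (2020) 20200348 = arXiv:1902.05993: §3 eqs. (eq:WOmV),
  (eq:main), (eq:a2), (eq:main2), (eq:gamma), (eq:sol) (chunks p0006 L36–L125, p0007 L1–L25);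
  §6.2 model fits `γ ≃ 2.31`, `T ≃ 2.250` (p0012); §7 (p0014). [`Barkley2020Teacup`]
* G. Luo, T. Y. Hou, Multiscale Model. Simul. 12 (2014) (the exponent `2.46`: tree
  `LuoHou2014.vorticityExponent`). [`LuoHou2014`]
-/

noncomputable section

open Set Filter
open _root_.Topology

namespace Literature.Analysis.FluidPDE

namespace Barkley2020

/-! ### The curvature ratio and the exponent `γ` -/

/-- Barkley's exponent as a function of the curvature-ratio parameter `a` (`a² ≡ Q/P`):
`γ ≡ (a² + 1)/(a² − 1)` (§3, eq. (eq:gamma)). Junk value at `a² = 1` (division by zero).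
[cite: Barkley2020Teacup, §3 eq. (eq:gamma) (arXiv:1902.05993 p0006 L120–L125)] -/
def gammaOfRatio (a : ℝ) : ℝ := (a ^ 2 + 1) / (a ^ 2 - 1)

/-- `γ = (Q + P)/(Q − P)` when `a² = Q/P` (§3, eq. (eq:gamma), second form).
[cite: Barkley2020Teacup, §3 eq. (eq:gamma) (arXiv:1902.05993 p0006 L122)] -/
theorem gammaOfRatio_eq_curvatures {P Q a : ℝ} (hP : P ≠ 0) (hQP : Q ≠ P) (ha : a ^ 2 = Q / P) :
    gammaOfRatio a = (Q + P) / (Q - P) := by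
  have hQP' : Q - P ≠ 0 := sub_ne_zero.mpr hQP
  rw [gammaOfRatio, ha]
  field_simp

/-- The inverse relation `a² = (γ + 1)/(γ − 1)` (so the printed `γ ≃ 2.46` "corresponds to
`a ≃ 1.54`"). [cite: Barkley2020Teacup, §3 (arXiv:1902.05993 p0007 L22: "γ ≃ 2.46, corresponding to a ≃ 1.54")] -/
theorem sq_ratio_eq_of_gamma {a γ : ℝ} (ha : a ^ 2 ≠ 1) (hγ : γ = gammaOfRatio a) :
    a ^ 2 = (γ + 1) / (γ - 1) := by
  have ha' : a ^ 2 - 1 ≠ 0 := sub_ne_zero.mpr ha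
  have hγ1 : γ - 1 = 2 / (a ^ 2 - 1) := by
    rw [hγ, gammaOfRatio, div_sub_one ha']
    ring_nf
  have hγ2 : γ + 1 = 2 * a ^ 2 / (a ^ 2 - 1) := by
    rw [hγ, gammaOfRatio, div_add_one ha']
    ring_nf
  have hγ1' : γ - 1 ≠ 0 := by
    rw [hγ1]; exact div_ne_zero two_ne_zero ha'
  rw [eq_div_iff hγ1', hγ1, hγ2]
  field_simp

/-- "The case of interest `∞ > a > 1` corresponds to `1 < γ < ∞`."
[cite: Barkley2020Teacup, §3 (arXiv:1902.05993 p0006 L125)] -/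
theorem one_lt_gammaOfRatio {a : ℝ} (ha : 1 < a) : 1 < gammaOfRatio a := by
  have h1 : 1 < a ^ 2 := by nlinarith
  rw [gammaOfRatio, lt_div_iff₀ (by linarith)]
  linarith

/-! ### The elimination on the critical ring -/

/-- From `P + Q = −2W²` (pressure Poisson on the ring) and `Q = a²P`: `P = −2W²/(a² + 1)`.
[cite: Barkley2020Teacup, §3 ("Using (eq:a2) to eliminate Q from (eq:PPEc) gives P = −2W²/(a²+1)", arXiv:1902.05993 p0006 L108–L110)] -/
theorem pressureCurvature_eq {P Q W a : ℝ} (hPQ : P + Q = -2 * W ^ 2) (ha : Q = a ^ 2 * P) :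
    P = -2 * W ^ 2 / (a ^ 2 + 1) := by
  have h1 : a ^ 2 + 1 ≠ 0 := by positivity
  rw [eq_div_iff h1]
  rw [ha] at hPQ
  linarith

/-- **The gradient law** `Ẇ = −W²/γ` on the critical ring: from `Ẇ + W² = −P`, `P + Q = −2W²`,
`Q = a²P`, `a² ≠ 1` (eq. (eq:main2)). Here `dW` stands for `Ẇ` at the instant considered.
[cite: Barkley2020Teacup, §3 eqs. (eq:main), (eq:main2) (arXiv:1902.05993 p0006 L60–L120)] -/
theorem gradient_law {P Q W dW a : ℝ} (hW : dW + W ^ 2 = -P) (hPQ : P + Q = -2 * W ^ 2)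
    (ha : Q = a ^ 2 * P) (h1 : a ^ 2 ≠ 1) : dW = -W ^ 2 / gammaOfRatio a := by
  have hP := pressureCurvature_eq hPQ ha
  have h2 : a ^ 2 + 1 ≠ 0 := by positivity
  have h3 : a ^ 2 - 1 ≠ 0 := sub_ne_zero.mpr h1
  rw [gammaOfRatio, div_div_eq_mul_div]
  rw [hP] at hW
  field_simp
  field_simp at hW
  linarith

/-! ### The explicit `γ`-constant solution -/

/-- `W(t) = −γ/(T − t)` (§3, eq. (eq:sol)). [cite: Barkley2020Teacup, §3 eq. (eq:sol) (arXiv:1902.05993 p0007 L9)] -/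
def ringW (γ T t : ℝ) : ℝ := -γ / (T - t)

/-- `Ω(t) = Ω₀ T^γ (T − t)^{−γ}` (= `Ω₀T^γ/(T−t)^γ` below the blow-up time, `ringOmega_eq_div`;
§3, eq. (eq:sol)). [cite: Barkley2020Teacup, §3 eq. (eq:sol) (arXiv:1902.05993 p0007 L9–L11)] -/
def ringOmega (Ω₀ γ T t : ℝ) : ℝ := Ω₀ * T ^ γ * (T - t) ^ (-γ)

/-- Below the blow-up time, `Ω(t) = Ω₀ T^γ / (T − t)^γ` as printed.
[cite: Barkley2020Teacup, §3 eq. (eq:sol) (arXiv:1902.05993 p0007 L9–L11)] -/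
theorem ringOmega_eq_div {Ω₀ γ T t : ℝ} (ht : t < T) :
    ringOmega Ω₀ γ T t = Ω₀ * T ^ γ / (T - t) ^ γ := by
  rw [ringOmega, Real.rpow_neg (sub_pos.mpr ht).le, div_eq_mul_inv]

/-- `W(0) = −γ/T`. [cite: Barkley2020Teacup, §3 eq. (eq:sol) ("T = −γ/W₀", arXiv:1902.05993 p0007 L13)] -/
theorem ringW_zero (γ T : ℝ) : ringW γ T 0 = -γ / T := by
  simp [ringW]

/-- **The blow-up time** `T = −γ/W₀` ("`T = −γ/W₀ > 0` is the singularity time"; `W₀ = W(0)`).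
[cite: Barkley2020Teacup, §3 eq. (eq:sol) (arXiv:1902.05993 p0007 L13)] -/
theorem blowupTime_eq {γ T : ℝ} (hγ : γ ≠ 0) (hT : T ≠ 0) : T = -γ / ringW γ T 0 := by
  rw [ringW_zero]
  field_simp

/-- The case of interest: `W₀ < 0` (axially converging flow) and `γ > 0` give `T > 0`.
[cite: Barkley2020Teacup, §3 ("always assume W(t=0) = W₀ < 0 … T = −γ/W₀ > 0", arXiv:1902.05993 p0007 L5–L13)] -/
theorem blowupTime_pos {γ W₀ : ℝ} (hγ : 0 < γ) (hW₀ : W₀ < 0) : 0 < -γ / W₀ :=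
  div_pos_of_neg_of_neg (neg_neg_of_pos hγ) hW₀

/-- **`W` solves the gradient law**: `Ẇ(t) = −W(t)²/γ` for `t ≠ T`.
[cite: Barkley2020Teacup, §3 eqs. (eq:main2), (eq:sol) (arXiv:1902.05993 p0006 L115, p0007 L9)] -/
theorem hasDerivAt_ringW {γ T t : ℝ} (ht : t ≠ T) :
    HasDerivAt (ringW γ T) (-(ringW γ T t) ^ 2 / γ) t := by
  have hTt : T - t ≠ 0 := sub_ne_zero.mpr (Ne.symm ht)
  have h1 : HasDerivAt (fun s : ℝ => T - s) (-1) t := (hasDerivAt_id t).const_sub T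
  have h2 : HasDerivAt (fun s : ℝ => -γ / (T - s)) (-(-γ * -1) / (T - t) ^ 2) t :=
    ((hasDerivAt_const t (-γ)).div h1 hTt).congr_deriv (by ring)
  have hval : -(-γ * -1) / (T - t) ^ 2 = -(ringW γ T t) ^ 2 / γ := by
    rw [ringW]
    by_cases hγ : γ = 0
    · simp [hγ]
    · field_simp
  rw [← hval]
  exact h2

/-- **`Ω` solves the vorticity law**: `Ω̇(t) = −W(t)Ω(t)` for `t < T`, `T > 0`.
[cite: Barkley2020Teacup, §3 eqs. (eq:main2), (eq:sol) (arXiv:1902.05993 p0006 L115, p0007 L9–L11)] -/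
theorem hasDerivAt_ringOmega {Ω₀ γ T t : ℝ} (ht : t < T) :
    HasDerivAt (ringOmega Ω₀ γ T) (-(ringW γ T t) * ringOmega Ω₀ γ T t) t := by
  have hTt : 0 < T - t := sub_pos.mpr ht
  have h1 : HasDerivAt (fun s : ℝ => T - s) (-1) t := (hasDerivAt_id t).const_sub T
  have h2 : HasDerivAt (fun s : ℝ => (T - s) ^ (-γ)) ((-1) * (-γ) * (T - t) ^ (-γ - 1)) t :=
    h1.rpow_const (Or.inl hTt.ne')
  have h3 : HasDerivAt (fun s : ℝ => Ω₀ * T ^ γ * (T - s) ^ (-γ))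
      (Ω₀ * T ^ γ * ((-1) * (-γ) * (T - t) ^ (-γ - 1))) t :=
    h2.const_mul (Ω₀ * T ^ γ)
  have hval : Ω₀ * T ^ γ * ((-1) * (-γ) * (T - t) ^ (-γ - 1)) =
      -(ringW γ T t) * ringOmega Ω₀ γ T t := by
    rw [ringW, ringOmega, Real.rpow_sub_one hTt.ne' (-γ)]
    field_simp
  rw [← hval]
  exact h3

/-- **`W → −∞` as `t ↑ T`** (for `γ > 0`): the axial velocity gradient on the ring diverges.
[cite: Barkley2020Teacup, §3 eq. (eq:sol) ("W ∼ (T−t)⁻¹", arXiv:1902.05993 p0007 L9)] -/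
theorem tendsto_ringW_atBot {γ T : ℝ} (hγ : 0 < γ) : Tendsto (ringW γ T) (𝓝[<] T) atBot := by
  have h0 : Tendsto (fun t : ℝ => T - t) (𝓝[<] T) (𝓝[>] 0) := by
    refine tendsto_nhdsWithin_of_tendsto_nhds_of_eventually_within _ ?_ ?_
    · have : Tendsto (fun t : ℝ => T - t) (𝓝 T) (𝓝 (T - T)) :=
        (continuous_const.sub continuous_id).tendsto T
      rw [sub_self] at this
      exact this.mono_left nhdsWithin_le_nhds
    · filter_upwards [self_mem_nhdsWithin] with t ht
      exact sub_pos.mpr (Set.mem_Iio.mp ht)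
  have h1 : Tendsto (fun t : ℝ => (T - t)⁻¹) (𝓝[<] T) atTop := tendsto_inv_nhdsGT_zero.comp h0
  have h2 : Tendsto (fun t : ℝ => -γ * (T - t)⁻¹) (𝓝[<] T) atBot :=
    h1.const_mul_atTop_of_neg (neg_neg_of_pos hγ)
  refine h2.congr fun t => ?_
  rw [ringW, div_eq_mul_inv]

/-- **`Ω → +∞` as `t ↑ T`** (for `Ω₀ > 0`, `T > 0`, `γ > 0`): "the vorticity `Ω = ‖ω‖_∞` diverges
with exponent `−γ`". [cite: Barkley2020Teacup, §3 eq. (eq:sol) (arXiv:1902.05993 p0007 L9–L12)] -/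
theorem tendsto_ringOmega_atTop {Ω₀ γ T : ℝ} (hΩ₀ : 0 < Ω₀) (hT : 0 < T) (hγ : 0 < γ) :
    Tendsto (ringOmega Ω₀ γ T) (𝓝[<] T) atTop := by
  have h0 : Tendsto (fun t : ℝ => T - t) (𝓝[<] T) (𝓝[>] 0) := by
    refine tendsto_nhdsWithin_of_tendsto_nhds_of_eventually_within _ ?_ ?_
    · have : Tendsto (fun t : ℝ => T - t) (𝓝 T) (𝓝 (T - T)) :=
        (continuous_const.sub continuous_id).tendsto T
      rw [sub_self] at this
      exact this.mono_left nhdsWithin_le_nhds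
    · filter_upwards [self_mem_nhdsWithin] with t ht
      exact sub_pos.mpr (Set.mem_Iio.mp ht)
  have h1 : Tendsto (fun t : ℝ => (T - t) ^ (-γ)) (𝓝[<] T) atTop :=
    (tendsto_rpow_neg_nhdsGT_zero (by linarith)).comp h0
  have hc : 0 < Ω₀ * T ^ γ := mul_pos hΩ₀ (Real.rpow_pos_of_pos hT γ)
  exact h1.const_mul_atTop hc

/-! ### The printed numbers -/

/-- "We know from LH that the vorticity diverges with exponent `γ ≃ 2.46`" (Luo–Hou's
`‖ω‖_∞ ∼ (t_s−t)^{−2.4568}`, tree `LuoHou2014.vorticityExponent`). Data.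
[cite: Barkley2020Teacup, §3 (arXiv:1902.05993 p0007 L22)] -/
def gammaLH : ℝ := 2.46

/-- "… corresponding to `a ≃ 1.54`." Data. [cite: Barkley2020Teacup, §3 (arXiv:1902.05993 p0007 L22)] -/
def aLH : ℝ := 1.54

/-- The wall model's fitted exponent `γ ≃ 2.31` (§6.2: "A least-squares fit … gives `γ ≃ 2.31` …
not very different from the value `≃ 2.46` obtained by LH"). Data (one code).
[cite: Barkley2020Teacup, §6.2 (arXiv:1902.05993 p0012)] -/
def gammaModelFit : ℝ := 2.31

/-- The wall model's extrapolated blow-up time `T ≃ 2.250` for the datum `u = −z/(1+z²)`,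
`θ = z²/(2(1+z²))` (§6.2). Data (one code). [cite: Barkley2020Teacup, §6.2 (arXiv:1902.05993 p0012)] -/
def modelBlowupTime : ℝ := 2.250

/-- **Consistency of the printed pair** `(γ, a) ≃ (2.46, 1.54)` with `a² = (γ+1)/(γ−1)`: the two
sides differ by less than `2·10⁻³` (`1.54² = 2.3716`, `3.46/1.46 = 2.3698…`). Kernel arithmetic.
[cite: Barkley2020Teacup, §3 (arXiv:1902.05993 p0007 L22)] -/
theorem abs_aLH_sq_sub_lt : |aLH ^ 2 - (gammaLH + 1) / (gammaLH - 1)| < 2e-3 := by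
  rw [aLH, gammaLH, abs_lt]
  constructor <;> norm_num

/-- The printed `γ ≃ 2.46 > 1` is in "the case of interest `1 < γ < ∞`".
[cite: Barkley2020Teacup, §3 (arXiv:1902.05993 p0006 L125, p0007 L22)] -/
theorem one_lt_gammaLH : 1 < gammaLH := by norm_num [gammaLH]

/-- The model's fitted exponent is below the Euler computation's: `2.31 < 2.46` (§6.2).
[cite: Barkley2020Teacup, §6.2 (arXiv:1902.05993 p0012)] -/
theorem gammaModelFit_lt_gammaLH : gammaModelFit < gammaLH := by
  norm_num [gammaModelFit, gammaLH]

end Barkley2020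

end Literature.Analysis.FluidPDE

end
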